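import Summits.HodgeConjecture.HodgeConjecture.Theorems.K2LiuSplitSliceOfTorusDecay   -- ★ p857141 (K2Liu-p05): the #32d slice frame; ★ (A1), ★ (A2), ★ H5 through it

/-!
# The finite slice of #32d ∕ #32dR from a CARTAN DECAY DATUM at the place (organ (NS-i) of (Bv-nonsplit); any rank, any index set)

Track B ∕ K2-LIT, hLiu418 = stmt-HodgeConjecture-24832; socket #32dR `sig_K2LiuDoublingHeightDecayLocalR2` (U5d ED. 5 :554) through ★ (R)
`K2LiuDoublingHeightDecayLocalOfSlices.doublingHeightDecayLocal_of_slices` (p856795) and ★ `K2LiuDoublingHeightDecayLocalR2OfFinSlices` (K2Liu-p02).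
LEAD F0P6-plan (g11) M-155c (2): organ (Bv-nonsplit) → K2Liu-p04 (g3); REPORT-FIRST `K2/K2Liu-p04/g3/REPORT-FIRST-32dR-BvNonsplit.K2Liup04g3.md` §1 (NS-i).

THE STATEMENT (`integrable_placeSlice_of_cartanDecay`, the ABSTRACT mirror of ★ K2Liu-p05 `integrable_placeSlice_of_localTorusDecay`).  In the frame of
#32d (`ιA : U(H)(𝔸) →* U(diag dV)(𝔸)` pinned by `hιA`, finite `S`, `v ∈ S`, Haar `ν` on `G_v = U(H)(L⁺_v)`, continuous height `Φ > 0` of type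
`(P_Δ, modDelta)` on `H(𝔸)`, real `τ > 0`), let `K₀ ≤ G_v` be compact open and `t : ι → G_v` a ★ `IsCartanFamily` for `K₀` (`G_v = ⊔_i K₀ t_i K₀`).  IF
the height is dominated along the family, `Φ(ι(ιA placesEmbed_S(1, t_i at v), 1)) ≤ C·w_i` with `w_i ≥ 0`, AND the Cartan series of the profile converges,
`∑_i ν(K₀ t_i K₀)·w_i^τ < ∞`, THEN the slice `u ↦ Φ(ι(ιA placesEmbed_S(1, u at v), 1))^τ` is `ν`-integrable — `_hfin v` of ★ (R).
COROLLARY (`integrable_placeSlice_of_rankOneDecay`, `ι = ℕ`): volume growth `ν(K₀ t_m K₀) ≤ C₁ Q^m` and geometric decay `Φ(slice t_m) ≤ C₂ r^m` with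
`r^τ·Q < 1` suffice — the shape of a NON-SPLIT place with `V_v` isotropic (`G_v ≅ U(1,1)(L_w∕L⁺_v)`, relative rank one: unramified `Q = q_v²`,
`r = q_v⁻¹`; ramified `Q = q_v`, `r = q_v^{−1∕2}`; either way `r^τ Q < 1 ⟺ τ > 2 = 2·2 − 2`, #32dR's sharp exponent).  The Cartan datum (row 26: ★
`K2LiuCartanFamilyInert` at inert unramified places, K2Liu-p01) and the decay (organ (D-n)) are the named inputs, supplied per place type.
PROOF: ★ (A1) `exists_placeSlice_quasiBiInvariant` (quasi-bi-invariance of the slice under the compact `K₀`, raised to the power `τ`), ★ (A2)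
`integrable_of_cartanSeries_of_isOpen` (the Cartan bound), compactness of `K₀ t_i K₀`, comparison of the Cartan series with `C^τ ∑ ν(K₀t_iK₀) w_i^τ`.
Theorems only; no `sorry`; default heartbeats.
[GelbartPiatetskishapiroRallis1987, Part A §6]; [Li1992, §3 Thm. 3.1]; [Liu2011, §2C p. 863]; [Macdonald1995, Ch. V §2 (2.9)]; [Garrett2018, §3.10].
HONEST LABEL: HC_CM is proved only modulo the 7 printed citations (2 remaining named inputs: hLiu418 = stmt-HodgeConjecture-24832, h413 =
stmt-HodgeConjecture-24833) until rung 0 closes; count-neutral helper toward #32dR (the slice MODULO the Cartan decay datum), retires nothing by itself.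
-/

set_option autoImplicit false
-- the mandated namespace repeats the single-problem summit's segment (`HodgeConjecture.HodgeConjecture`)
set_option linter.dupNamespace false

noncomputable section

open scoped Matrix ENNReal
open NumberField IsDedekindDomain MeasureTheory

namespace Summit.HodgeConjecture.HodgeConjecture.Cruxes.HLiu418.K2LiuNonsplitSliceOfRankOneDecay

open Literature.NumberTheory.Automorphic Literature.NumberTheory.Automorphic.UnitaryGroup
open Literature.NumberTheory.GelbartRogawski1991 Literature.NumberTheory.GelbartRogawski1991.GRConstruction
open Literature.NumberTheory.K2Lit.SiegelDoubled Literature.NumberTheory.K2Lit.PlaceSplitting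
open Summit.HodgeConjecture.HodgeConjecture.Cruxes.HLiu418.K2LiuDoublingUnfoldBridge
open Summit.HodgeConjecture.HodgeConjecture.Cruxes.HLiu418.K2LiuDoublingHeightSliceQuasiInvariance
open Summit.HodgeConjecture.HodgeConjecture.Cruxes.HLiu418.K2LiuDoublingHeightSliceCartanBound

variable (L : Type) [Field L] [NumberField L] [IsCMField L]
variable {N M n : ℕ} (e : Fin N × Fin M ≃ Fin n)
  (dV : Fin N → L) (hdV : ∀ i, IsCMField.complexConj L (dV i) = dV i)
  (dW : Fin M → L) (hdW : ∀ i, IsCMField.complexConj L (dW i) = dW i)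
  (H : Matrix (Fin N) (Fin N) L) (t : L) (ht : t ≠ 0) (g : GL (Fin N) L)
  (hg : formCongr ((IsCMField.complexConj L : L ≃ₐ[↥(maximalRealSubfield L)] L) : L →+* L) g (t • H) = Matrix.diagonal dV)
  (ιA : (UnitaryGroup.adelicGroupData (Fp L) L (IsCMField.complexConj L) N H).Adelic →*
    UnitaryGroup.adelic (Fp L) L (IsCMField.complexConj L) N (Matrix.diagonal dV))
  (hιA : ∀ k, ((ιA k : ↥(UnitaryGroup.adelic (Fp L) L (IsCMField.complexConj L) N (Matrix.diagonal dV))) :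
        GL (Fin N) (AdeleRing (𝓞 L) L)) =
      (toAdeleGL L g)⁻¹ * UnitaryGroup.adelicVal (Fp L) L (IsCMField.complexConj L) N H k * toAdeleGL L g)
  (S : Finset (HeightOneSpectrum (𝓞 (Fp L)))) [DecidableEq (HeightOneSpectrum (𝓞 (Fp L)))]

/-! ## §1 Real-power bookkeeping -/

/-- `(r^m)^τ = (r^τ)^m` for `r ≥ 0`. [cite: Garrett2018, §3.10] -/
theorem rpow_pow_comm {r : ℝ} (hr : 0 ≤ r) (m : ℕ) (τ : ℝ) : (r ^ m) ^ τ = (r ^ τ) ^ m := by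
  rw [← Real.rpow_natCast r m, ← Real.rpow_mul hr, mul_comm, Real.rpow_mul hr, Real.rpow_natCast]

/-- the geometric Cartan series: `ν_m ≤ C₁ Q^m`, `0 ≤ ν_m`, `0 ≤ r`, `0 ≤ Q`, `r^τ Q < 1` ⇒ `∑_m ν_m (r^m)^τ < ∞`. [cite: Macdonald1995, Ch. V §2 (2.9)] -/
theorem summable_geometric_cartanSeries {νm : ℕ → ℝ} (hν0 : ∀ m, 0 ≤ νm m) {C₁ Q r τ : ℝ} (hQ : 0 ≤ Q) (hr : 0 ≤ r)
    (hvol : ∀ m, νm m ≤ C₁ * Q ^ m) (hrQ : r ^ τ * Q < 1) : Summable fun m => νm m * (r ^ m) ^ τ := by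
  have hρ0 : 0 ≤ r ^ τ * Q := mul_nonneg (Real.rpow_nonneg hr τ) hQ
  refine Summable.of_nonneg_of_le (fun m => mul_nonneg (hν0 m) (Real.rpow_nonneg (pow_nonneg hr m) τ))
    (fun m => ?_) ((summable_geometric_of_lt_one hρ0 hrQ).mul_left C₁)
  rw [rpow_pow_comm hr, mul_pow, mul_comm ((r ^ τ) ^ m), ← mul_assoc]
  exact mul_le_mul_of_nonneg_right (hvol m) (pow_nonneg (Real.rpow_nonneg hr τ) m)

/-! ## §2 The slice from a Cartan decay datum -/

include ht hg hιA in
/-- **THE FINITE SLICE OF #32d FROM A CARTAN DECAY DATUM AT THE PLACE** (any `N`, any countable index set).  See the module docstring.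
[cite: GelbartPiatetskishapiroRallis1987, Part A §6] [cite: Li1992, §3 Thm. 3.1] [cite: Liu2011, §2C p. 863] [cite: Macdonald1995, Ch. V §2 (2.9)] -/
theorem integrable_placeSlice_of_cartanDecay (hdV0 : ∀ i, dV i ≠ 0) (hdW0 : ∀ i, dW i ≠ 0) (v : S)
    [MeasurableSpace (UnitaryGroup.localPi L (IsCMField.complexConj L) N H v.1)]
    [BorelSpace (UnitaryGroup.localPi L (IsCMField.complexConj L) N H v.1)]
    (ν : Measure (UnitaryGroup.localPi L (IsCMField.complexConj L) N H v.1)) [ν.IsHaarMeasure]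
    {Φ : HA L e dV hdV dW hdW → ℝ} (hΦc : Continuous Φ) (hΦpos : ∀ x, 0 < Φ x)
    (hΦ : ∀ p x : HA L e dV hdV dW hdW, IsSiegelDelta L e dV hdV dW hdW p →
      Φ (p * x) = modDelta L e dV hdV dW hdW p * Φ x)
    -- the Cartan decay datum at `v`
    {K₀ : Subgroup (UnitaryGroup.localPi L (IsCMField.complexConj L) N H v.1)}
    (hK₀o : IsOpen (K₀ : Set (UnitaryGroup.localPi L (IsCMField.complexConj L) N H v.1)))
    (hK₀c : IsCompact (K₀ : Set (UnitaryGroup.localPi L (IsCMField.complexConj L) N H v.1)))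
    {ι : Type} [Countable ι] {tv : ι → UnitaryGroup.localPi L (IsCMField.complexConj L) N H v.1} (htv : IsCartanFamily K₀ tv)
    {τ : ℝ} (hτ0 : 0 < τ) {C : ℝ} (hC : 0 ≤ C) {w : ι → ℝ} (hw0 : ∀ i, 0 ≤ w i)
    (hdec : ∀ i, Φ (iotaLeft L e dV hdV dW hdW (ιA (placesEmbed L H S (1, Pi.mulSingle v (tv i))))) ≤ C * w i)
    (hsum : Summable fun i => (ν (DoubleCoset.doubleCoset (tv i) (K₀ : Set _) K₀)).toReal * w i ^ τ) :
    Integrable (fun u => Φ (iotaLeft L e dV hdV dW hdW (ιA (placesEmbed L H S (1, Pi.mulSingle v u)))) ^ τ) ν := by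
  -- continuity of `ιA` and of the slice
  obtain ⟨Ψ, -, hΨ⟩ := exists_continuousMulEquiv_eq_iotaA L H dV t ht g hg ιA hιA
  have hιc : Continuous ιA := by
    have h : (ιA : _ → _) = Ψ := funext fun x => (hΨ x).symm
    rw [h]
    exact Ψ.continuous
  have hslc : Continuous fun u : UnitaryGroup.localPi L (IsCMField.complexConj L) N H v.1 =>
      iotaLeft L e dV hdV dW hdW (ιA (placesEmbed L H S (1, Pi.mulSingle v u))) :=
    (continuous_iotaLeft L e dV hdV dW hdW).comp (hιc.comp ((continuous_placesEmbed L H S).comp (continuous_const.prodMk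
      (continuous_mulSingle (A := fun w : S => UnitaryGroup.localPi L (IsCMField.complexConj L) N H w.1) v))))
  have hψm : AEStronglyMeasurable
      (fun u => Φ (iotaLeft L e dV hdV dW hdW (ιA (placesEmbed L H S (1, Pi.mulSingle v u)))) ^ τ) ν :=
    ((hΦc.comp hslc).rpow_const fun _ => Or.inl (hΦpos _).ne').aestronglyMeasurable
  have hψ0 : ∀ u, 0 ≤ Φ (iotaLeft L e dV hdV dW hdW (ιA (placesEmbed L H S (1, Pi.mulSingle v u)))) ^ τ :=
    fun u => Real.rpow_nonneg (hΦpos _).le τ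
  -- quasi-bi-invariance under the compact `K₀` (★ (A1)), raised to the power `τ`
  obtain ⟨c, hc, hq⟩ := exists_placeSlice_quasiBiInvariant L e dV hdV dW hdW H ιA S hdV0 hdW0 hιc v hΦc hΦpos hΦ hK₀c hK₀c
  have hquasi : ∀ x ∈ K₀, ∀ y ∈ K₀, ∀ u : UnitaryGroup.localPi L (IsCMField.complexConj L) N H v.1,
      Φ (iotaLeft L e dV hdV dW hdW (ιA (placesEmbed L H S (1, Pi.mulSingle v (x * u * y))))) ^ τ ≤
        c ^ τ * Φ (iotaLeft L e dV hdV dW hdW (ιA (placesEmbed L H S (1, Pi.mulSingle v u)))) ^ τ := by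
    intro x hx y hy u
    rw [← Real.mul_rpow hc.le (hΦpos _).le]
    exact Real.rpow_le_rpow (hΦpos _).le ((hq u x hx y hy).1) hτ0.le
  -- the double cosets `K₀ t_i K₀ = K₀ · {t_i} · K₀` are compact, hence of finite measure
  have hfin : ∀ i, ν (DoubleCoset.doubleCoset (tv i) (K₀ : Set _) K₀) ≠ ∞ :=
    fun i => ((hK₀c.mul isCompact_singleton).mul hK₀c).measure_lt_top.ne
  -- the Cartan series of the slice is dominated by `C^τ ∑ ν(K₀ t_i K₀) w_i^τ`
  have hseries : Summable fun i => (ν (DoubleCoset.doubleCoset (tv i) (K₀ : Set _) K₀)).toReal *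
      Φ (iotaLeft L e dV hdV dW hdW (ιA (placesEmbed L H S (1, Pi.mulSingle v (tv i))))) ^ τ := by
    refine Summable.of_nonneg_of_le (fun i => mul_nonneg ENNReal.toReal_nonneg (hψ0 _)) (fun i => ?_) (hsum.mul_left (C ^ τ))
    calc (ν (DoubleCoset.doubleCoset (tv i) (K₀ : Set _) K₀)).toReal *
          Φ (iotaLeft L e dV hdV dW hdW (ιA (placesEmbed L H S (1, Pi.mulSingle v (tv i))))) ^ τ
        ≤ (ν (DoubleCoset.doubleCoset (tv i) (K₀ : Set _) K₀)).toReal * (C * w i) ^ τ :=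
          mul_le_mul_of_nonneg_left (Real.rpow_le_rpow (hΦpos _).le (hdec i) hτ0.le) ENNReal.toReal_nonneg
      _ = C ^ τ * ((ν (DoubleCoset.doubleCoset (tv i) (K₀ : Set _) K₀)).toReal * w i ^ τ) := by
          rw [Real.mul_rpow hC (hw0 i)]; ring
  exact integrable_of_cartanSeries_of_isOpen ν hK₀o htv hfin hψm hψ0 (Real.rpow_nonneg hc.le τ) hquasi hseries

include ht hg hιA in
/-- **THE FINITE SLICE AT A RANK-ONE PLACE FROM VOLUME GROWTH AND GEOMETRIC DECAY** (the (NS-i) shape: `V_v` isotropic at a non-split `v`,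
`G_v ≅ U(1,1)(L_w∕L⁺_v)`).  With a Cartan family `t : ℕ → G_v` for a compact open `K₀`, volumes `ν(K₀ t_m K₀) ≤ C₁ Q^m` and decay
`Φ(ι(ιA placesEmbed_S(1, t_m at v), 1)) ≤ C₂ r^m` (`Q, r, C₂ ≥ 0`), the slice is `ν`-integrable as soon as `r^τ·Q < 1` (`τ > 0`) — at `N = 2`:
unramified `Q = q_v², r = q_v⁻¹`, ramified `Q = q_v, r = q_v^{−1∕2}`, i.e. `τ > 2`, the sharp exponent of #32dR.
[cite: GelbartPiatetskishapiroRallis1987, Part A §6] [cite: Li1992, §3 Thm. 3.1] [cite: Liu2011, §2C p. 863] [cite: Macdonald1995, Ch. V §2 (2.9)] -/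
theorem integrable_placeSlice_of_rankOneDecay (hdV0 : ∀ i, dV i ≠ 0) (hdW0 : ∀ i, dW i ≠ 0) (v : S)
    [MeasurableSpace (UnitaryGroup.localPi L (IsCMField.complexConj L) N H v.1)]
    [BorelSpace (UnitaryGroup.localPi L (IsCMField.complexConj L) N H v.1)]
    (ν : Measure (UnitaryGroup.localPi L (IsCMField.complexConj L) N H v.1)) [ν.IsHaarMeasure]
    {Φ : HA L e dV hdV dW hdW → ℝ} (hΦc : Continuous Φ) (hΦpos : ∀ x, 0 < Φ x)
    (hΦ : ∀ p x : HA L e dV hdV dW hdW, IsSiegelDelta L e dV hdV dW hdW p →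
      Φ (p * x) = modDelta L e dV hdV dW hdW p * Φ x)
    -- the rank-one Cartan datum at `v`
    {K₀ : Subgroup (UnitaryGroup.localPi L (IsCMField.complexConj L) N H v.1)}
    (hK₀o : IsOpen (K₀ : Set (UnitaryGroup.localPi L (IsCMField.complexConj L) N H v.1)))
    (hK₀c : IsCompact (K₀ : Set (UnitaryGroup.localPi L (IsCMField.complexConj L) N H v.1)))
    {tv : ℕ → UnitaryGroup.localPi L (IsCMField.complexConj L) N H v.1} (htv : IsCartanFamily K₀ tv)
    {C₁ Q : ℝ} (hQ : 0 ≤ Q) (hvol : ∀ m, (ν (DoubleCoset.doubleCoset (tv m) (K₀ : Set _) K₀)).toReal ≤ C₁ * Q ^ m)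
    {τ : ℝ} (hτ0 : 0 < τ) {C₂ r : ℝ} (hC₂ : 0 ≤ C₂) (hr : 0 ≤ r) (hrQ : r ^ τ * Q < 1)
    (hdec : ∀ m, Φ (iotaLeft L e dV hdV dW hdW (ιA (placesEmbed L H S (1, Pi.mulSingle v (tv m))))) ≤ C₂ * r ^ m) :
    Integrable (fun u => Φ (iotaLeft L e dV hdV dW hdW (ιA (placesEmbed L H S (1, Pi.mulSingle v u)))) ^ τ) ν :=
  integrable_placeSlice_of_cartanDecay L e dV hdV dW hdW H t ht g hg ιA hιA S hdV0 hdW0 v ν hΦc hΦpos hΦ hK₀o hK₀c htv hτ0 hC₂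
    (fun m => pow_nonneg hr m) hdec
    (summable_geometric_cartanSeries (fun _ => ENNReal.toReal_nonneg) hQ hr hvol hrQ)

end Summit.HodgeConjecture.HodgeConjecture.Cruxes.HLiu418.K2LiuNonsplitSliceOfRankOneDecay

end
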